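import Literature.NumberTheory.Transcendental.QuadraticRelationsLogarithmsPlacesBridge
import Literature.NumberTheory.DiophantineGeometry.FunctionFieldGenusEllZeroProofs
import Mathlib.RingTheory.Valuation.LocalSubring
import Mathlib.FieldTheory.IsAlgClosed.Basic
import Mathlib.Algebra.Module.Torsion.Field
import Mathlib.FieldTheory.Minpoly.IsIntegrallyClosed
import Mathlib.RingTheory.Polynomial.RationalRoot
import Mathlib.RingTheory.Algebraic.Basic
import Mathlib.FieldTheory.Relrank
import Mathlib.Analysis.Complex.Basic
import Literature.NumberTheory.DiophantineGeometry.FunctionFieldGenusApproximationProofs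
import HarnessLib

/-!
# Roy–Waldschmidt 1997, §3 (i): the place of `K` attached to an algebraic approximation

D. Roy, M. Waldschmidt, *Approximation diophantienne et indépendance algébrique de logarithmes*,
Ann. Sci. ÉNS (4) 30 (1997) 753–796, proof of Théorème 3.1, pp. 764–765:
"il existe un homomorphisme d'anneaux `τ : A → ℚ̄` … En vertu du théorème 1 du chapitre 1 de [5]
(Chevalley), l'homomorphisme `τ` s'étend en un homomorphisme d'anneaux `τ : 𝒪 → ℚ̄` où `𝒪` est
un anneau de valuation de `K` qui contient `A`. Soit `𝔭` l'idéal maximal de cet anneau. Alors,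
`𝔭` est une place non triviale de `K` sur `ℚ` et `τ` définit un plongement dans `ℂ` de son corps
résiduel `K̃`. De plus, si on désigne par `D` le degré de `𝔭` sur `ℚ`, on a `d ≤ D ≤ [K:ℚ(θ)]d`."

We prove this step (`exists_place_of_specialization`) in the following explicit algebraic form,
which avoids the analytic parametrisation `φ` of the paper (the ring `A` is replaced by
`A₀ = ℚ[θ][β]` for a generator `β` of `K/ℚ(θ)` integral over `ℚ[θ]`, and the point `ã = φ(α)`
by a root `β̃` of the specialisation at `θ ↦ α` of the minimal polynomial of `β`): given
`θ ∈ K` transcendental, `β ∈ K` integral over `ℚ[θ]`, an algebraic `α ∈ ℂ` and a root `β̃ ∈ ℂ`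
of the specialised minimal polynomial, there are a place `𝔭` of `K/ℚ`, a reduction map
`τ : 𝒪_𝔭 → ℂ` and the number field `K̃ = τ(𝒪_𝔭) ⊂ ℂ` of degree `D = deg 𝔭` with `θ, β ∈ 𝒪_𝔭`,
`τ(θ) = α`, `τ(β) = β̃` and `deg α ≤ D ≤ [K : ℚ(θ)] · deg α`.
Ingredients: `ℚ[θ] ≅ ℚ[X]` (`Polynomial.algEquivOfTranscendental`), `ℚ[θ][β] ≅ ℚ[θ][X]/(minpoly)`
(`minpoly.equivAdjoin`), Chevalley's extension theorem (Mathlib's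
`IsLocalRing.exists_factor_valuationRing`), Stichtenoth Thm. 1.1.6 (the library's
`isDiscreteValuationRing_of_ne_top_holds`), extension of embeddings into `ℂ`
(`IsAlgClosed.lift`) and Stichtenoth Prop. 1.3.3 (`sum_ord_mul_degree_le_finrank`) for the
degree bound.  No definitions, no named facts.

## References

* [RoyWaldschmidt1997ENS] D. Roy, M. Waldschmidt, Ann. Sci. ÉNS (4) 30 (1997) 753–796, §3 (i),
  pp. 764–765.
* C. Chevalley, *Introduction to the theory of algebraic functions of one variable*, AMS 1951,
  I §2 (extension of places).
-/

noncomputable section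

open Polynomial IntermediateField

namespace Literature.NumberTheory.Transcendental

namespace RoyWaldschmidt1997

open Literature.NumberTheory.DiophantineGeometry
open Literature.NumberTheory.DiophantineGeometry.AlgFunctionField

variable {K : IntermediateField ℚ ℂ}


/-- In a valuation subring, a nonzero element lies in the maximal ideal iff its inverse is not in
the ring. [folklore] -/
theorem ValuationSubring.mk_mem_maximalIdeal_iff (S : ValuationSubring K) {x : K} (hx : x ∈ S) (hx0 : x ≠ 0) :
    (⟨x, hx⟩ : S) ∈ IsLocalRing.maximalIdeal S ↔ x⁻¹ ∉ S := by
  rw [IsLocalRing.mem_maximalIdeal, mem_nonunits_iff, not_iff_not]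
  constructor
  · intro hu
    obtain ⟨u, hu⟩ := hu
    have h3 : ((u⁻¹ : Sˣ) : S) * ⟨x, hx⟩ = 1 := by rw [← hu, Units.inv_mul]
    have h4 : ((((u⁻¹ : Sˣ) : S) : K)) * x = 1 := by
      have := congrArg (fun z : S => (z : K)) h3
      simpa using this
    have h2 : (((u⁻¹ : Sˣ) : S) : K) = x⁻¹ := eq_inv_of_mul_eq_one_left h4
    rw [← h2]; exact ((u⁻¹ : Sˣ) : S).2
  · intro hinv
    exact IsUnit.of_mul_eq_one ⟨x⁻¹, hinv⟩ (Subtype.ext (mul_inv_cancel₀ hx0))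


set_option synthInstance.maxHeartbeats 400000 in
set_option maxHeartbeats 1600000 in
/-- **Step 2 (Chevalley): a homomorphism `τ₀ : A₀ → ℂ` with algebraic values and nontrivial
kernel extends to the reduction map of a place.** [cite: RoyWaldschmidt1997ENS, §3 (i), p. 765] -/
theorem exists_place_of_hom [IsAlgFunctionField ℚ K] (A₀ : Subalgebra ℚ K) (τ₀ : A₀ →ₐ[ℚ] ℂ)
    (halg : ∀ x : A₀, IsAlgebraic ℚ (τ₀ x)) (hker : ∃ x : A₀, x ≠ 0 ∧ τ₀ x = 0) :
    ∃ (p : Place K) (τ : p.ring →+* ℂ) (Kt : IntermediateField ℚ ℂ), p.IsReduction τ ∧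
      (∀ x, τ x ∈ Kt) ∧ FiniteDimensional ℚ Kt ∧ Module.finrank ℚ Kt = p.deg ∧
      ∃ hA : ∀ a : A₀, (a : K) ∈ p.ring, (∀ a : A₀, τ ⟨a, hA a⟩ = τ₀ a) ∧
        ∀ a : A₀, τ₀ a = 0 → a ≠ 0 → 0 < p.ord (a : K) := by
  classical
  set 𝔪 : Ideal A₀ := RingHom.ker τ₀.toRingHom with h𝔪
  -- `𝔪` is maximal: the image of `τ₀` is a field
  haveI halg' : Algebra.IsAlgebraic ℚ τ₀.range := by
    refine ⟨fun y => ?_⟩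
    obtain ⟨x, hx⟩ := y.2
    have h1 : IsAlgebraic ℚ (y : ℂ) := hx ▸ halg x
    exact (isAlgebraic_algHom_iff τ₀.range.val Subtype.coe_injective).mp h1
  haveI : Algebra.IsIntegral ℚ τ₀.range := Algebra.isAlgebraic_iff_isIntegral.mp halg'
  have hfield : IsField τ₀.range := isField_of_isIntegral_of_isField' (S := τ₀.range) Rat.instField.toIsField
  have hsurj : Function.Surjective τ₀.rangeRestrict.toRingHom := τ₀.rangeRestrict_surjective
  haveI h𝔪max : 𝔪.IsMaximal := by
    have hk : RingHom.ker τ₀.rangeRestrict.toRingHom = 𝔪 := by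
      ext a; simp [h𝔪, RingHom.mem_ker, Subtype.ext_iff]
    have e := RingHom.quotientKerEquivOfSurjective hsurj
    have e' : (A₀ ⧸ 𝔪) ≃+* τ₀.range := (Ideal.quotEquivOfEq hk).symm.trans e
    exact Ideal.Quotient.maximal_of_isField 𝔪 (MulEquiv.isField hfield e'.toMulEquiv)
  -- the localisation `(A₀)_𝔪 → K` and a valuation ring dominating it (Chevalley)
  have hunit : ∀ y : 𝔪.primeCompl, IsUnit ((A₀.val : A₀ →+* K) y) := by
    intro y
    have hy : (y : A₀) ∉ 𝔪 := y.2
    have hy0 : ((y : A₀) : K) ≠ 0 := by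
      intro h0
      apply hy
      have : (y : A₀) = 0 := Subtype.ext h0
      rw [this]; exact Ideal.zero_mem _
    exact isUnit_iff_ne_zero.mpr hy0
  set f : Localization.AtPrime 𝔪 →+* K := IsLocalization.lift (M := 𝔪.primeCompl) hunit with hf
  obtain ⟨O, hO, hloc⟩ := IsLocalRing.exists_factor_valuationRing f
  have hfalg : ∀ a : A₀, f (algebraMap A₀ (Localization.AtPrime 𝔪) a) = (a : K) := fun a =>
    IsLocalization.lift_eq hunit a
  have hAO : ∀ a : A₀, (a : K) ∈ O := fun a => by rw [← hfalg a]; exact hO _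
  -- `𝔪_O ∩ A₀ = 𝔪`
  have hmax1 : ∀ a : A₀, a ∈ 𝔪 → (⟨(a : K), hAO a⟩ : O) ∈ IsLocalRing.maximalIdeal O := by
    intro a ha
    have h1 : algebraMap A₀ (Localization.AtPrime 𝔪) a ∈ IsLocalRing.maximalIdeal (Localization.AtPrime 𝔪) :=
      (IsLocalization.AtPrime.to_map_mem_maximal_iff (Localization.AtPrime 𝔪) 𝔪 a).mpr ha
    have h2 : ¬ IsUnit (algebraMap A₀ (Localization.AtPrime 𝔪) a) :=
      (IsLocalRing.mem_maximalIdeal _).mp h1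
    rw [IsLocalRing.mem_maximalIdeal]
    intro hu
    apply h2
    have hu' : IsUnit ((f.codRestrict O.toSubring hO) (algebraMap A₀ (Localization.AtPrime 𝔪) a)) := by
      have e : (f.codRestrict O.toSubring hO) (algebraMap A₀ (Localization.AtPrime 𝔪) a) =
          ⟨(a : K), hAO a⟩ := Subtype.ext (hfalg a)
      rw [e]; exact hu
    exact (isUnit_map_iff (f.codRestrict O.toSubring hO) _).mp hu'
  have hmax2 : ∀ a : A₀, a ∉ 𝔪 → IsUnit (⟨(a : K), hAO a⟩ : O) := by
    intro a ha
    have h1 : IsUnit (algebraMap A₀ (Localization.AtPrime 𝔪) a) :=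
      (IsLocalization.AtPrime.isUnit_to_map_iff (Localization.AtPrime 𝔪) 𝔪 a).mpr ha
    have h2 := h1.map (f.codRestrict O.toSubring hO)
    have e : (f.codRestrict O.toSubring hO) (algebraMap A₀ (Localization.AtPrime 𝔪) a) =
        ⟨(a : K), hAO a⟩ := Subtype.ext (hfalg a)
    rwa [e] at h2
  -- `O ≠ K`
  obtain ⟨x₀, hx₀0, hx₀⟩ := hker
  have hx₀𝔪 : x₀ ∈ 𝔪 := hx₀
  have hOtop : O ≠ ⊤ := by
    intro htop
    have hx0K : ((x₀ : A₀) : K) ≠ 0 := fun h => hx₀0 (Subtype.ext h)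
    have hinv : ((x₀ : A₀) : K)⁻¹ ∈ O := by rw [htop]; exact ValuationSubring.mem_top _
    have hu : IsUnit (⟨(x₀ : K), hAO x₀⟩ : O) :=
      IsUnit.of_mul_eq_one ⟨_, hinv⟩ (Subtype.ext (mul_inv_cancel₀ hx0K))
    exact (IsLocalRing.mem_maximalIdeal _).mp (hmax1 x₀ hx₀𝔪) hu
  have hℚO : ∀ c : ℚ, algebraMap ℚ K c ∈ O := fun c => by
    have : algebraMap ℚ K c = ((algebraMap ℚ A₀ c : A₀) : K) := rfl
    rw [this]; exact hAO _
  -- the place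
  set v : PlaceOver ℚ K := ⟨O, hOtop, IsAlgFunctionField.isDiscreteValuationRing_of_ne_top_holds O hOtop hℚO, hℚO⟩ with hv
  set p : Place K := placeOfPlaceOver v with hp
  have hpO : p.ring = O := placeOfPlaceOver_ring v
  have hAp : ∀ a : A₀, (a : K) ∈ p.ring := fun a => by rw [hpO]; exact hAO a
  -- membership of `A₀`-elements in `𝔪_p`
  have hmaxp : ∀ a : A₀, a ∈ 𝔪 ↔ (⟨(a : K), hAp a⟩ : p.ring) ∈ IsLocalRing.maximalIdeal p.ring := by
    intro a
    by_cases ha0 : (a : K) = 0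
    · have : a = 0 := Subtype.ext ha0
      subst this
      simp only [Ideal.zero_mem, true_iff]
      have : (⟨((0 : A₀) : K), hAp 0⟩ : p.ring) = 0 := Subtype.ext rfl
      rw [this]; exact Ideal.zero_mem _
    rw [ValuationSubring.mk_mem_maximalIdeal_iff p.ring (hAp a) ha0, hpO,
      ← ValuationSubring.mk_mem_maximalIdeal_iff O (hAO a) ha0]
    constructor
    · exact hmax1 a
    · intro h
      by_contra hna
      exact (IsLocalRing.mem_maximalIdeal _).mp h (hmax2 a hna)
  -- the embedding of the residue field extending `τ₀`
  set ιp : A₀ →+* p.ring := (A₀.val : A₀ →+* K).codRestrict p.ring (fun a => hAp a) with hιp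
  have hιp_apply : ∀ a : A₀, ιp a = ⟨(a : K), hAp a⟩ := fun a => rfl
  letI : Field (A₀ ⧸ 𝔪) := Ideal.Quotient.field 𝔪
  set ψκ : A₀ ⧸ 𝔪 →+* IsLocalRing.ResidueField p.ring :=
    Ideal.Quotient.lift 𝔪 ((IsLocalRing.residue p.ring).comp ιp) (fun a ha => by
      rw [RingHom.comp_apply, IsLocalRing.residue_eq_zero_iff, hιp_apply]
      exact (hmaxp a).mp ha) with hψκ
  set ψℂ : A₀ ⧸ 𝔪 →+* ℂ := Ideal.Quotient.lift 𝔪 τ₀.toRingHom (fun a ha => ha) with hψℂ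
  letI algκ : Algebra (A₀ ⧸ 𝔪) (IsLocalRing.ResidueField p.ring) := ψκ.toAlgebra
  letI algℂ : Algebra (A₀ ⧸ 𝔪) ℂ := ψℂ.toAlgebra
  haveI : FiniteDimensional ℚ (IsLocalRing.ResidueField p.ring) := p.finiteDimensional_residueField
  haveI : Algebra.IsAlgebraic (A₀ ⧸ 𝔪) (IsLocalRing.ResidueField p.ring) := by
    refine ⟨fun r => ?_⟩
    have hr : IsAlgebraic ℚ r := Algebra.IsAlgebraic.isAlgebraic r
    obtain ⟨q, hq0, hq⟩ := hr
    refine ⟨q.map (algebraMap ℚ (A₀ ⧸ 𝔪)), ?_, ?_⟩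
    · exact (Polynomial.map_ne_zero_iff (algebraMap ℚ (A₀ ⧸ 𝔪)).injective).mpr hq0
    · haveI : IsScalarTower ℚ (A₀ ⧸ 𝔪) (IsLocalRing.ResidueField p.ring) :=
        IsScalarTower.of_algebraMap_eq fun c => by
          rw [eq_ratCast (algebraMap ℚ (IsLocalRing.ResidueField p.ring)) c]
          exact (eq_ratCast ((algebraMap (A₀ ⧸ 𝔪) (IsLocalRing.ResidueField p.ring)).comp
            (algebraMap ℚ (A₀ ⧸ 𝔪))) c).symm
      rw [Polynomial.aeval_map_algebraMap]
      exact hq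
  haveI : Module.IsTorsionFree (A₀ ⧸ 𝔪) (IsLocalRing.ResidueField p.ring) :=
    DivisionSemiring.to_moduleIsTorsionFree
  haveI : Module.IsTorsionFree (A₀ ⧸ 𝔪) ℂ := DivisionSemiring.to_moduleIsTorsionFree
  set ψ : IsLocalRing.ResidueField p.ring →ₐ[A₀ ⧸ 𝔪] ℂ := IsAlgClosed.lift with hψdef
  set τ : p.ring →+* ℂ := ψ.toRingHom.comp (IsLocalRing.residue p.ring) with hτ
  -- `τ` extends `τ₀`
  have hττ₀ : ∀ a : A₀, τ ⟨(a : K), hAp a⟩ = τ₀ a := by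
    intro a
    have h1 : (IsLocalRing.residue p.ring) ⟨(a : K), hAp a⟩ =
        algebraMap (A₀ ⧸ 𝔪) (IsLocalRing.ResidueField p.ring) (Ideal.Quotient.mk 𝔪 a) := by
      show _ = ψκ (Ideal.Quotient.mk 𝔪 a)
      rw [hψκ, Ideal.Quotient.lift_mk, RingHom.comp_apply, hιp_apply]
    rw [hτ, RingHom.comp_apply, h1, AlgHom.toRingHom_eq_coe, AlgHom.coe_toRingHom, AlgHom.commutes]
    show ψℂ (Ideal.Quotient.mk 𝔪 a) = τ₀ a
    rw [hψℂ, Ideal.Quotient.lift_mk]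
    rfl
  -- the number field `K̃ ⊂ ℂ`
  set ψℚ : IsLocalRing.ResidueField p.ring →ₐ[ℚ] ℂ :=
    { ψ.toRingHom with
      commutes' := fun c => by
        simp only [RingHom.toMonoidHom_eq_coe, OneHom.toFun_eq_coe, MonoidHom.toOneHom_coe,
          MonoidHom.coe_coe]
        rw [eq_ratCast (algebraMap ℚ (IsLocalRing.ResidueField p.ring)) c, map_ratCast,
          eq_ratCast (algebraMap ℚ ℂ) c] } with hψℚ
  have hψℚ_apply : ∀ r, ψℚ r = ψ r := fun r => rfl
  set Kt : IntermediateField ℚ ℂ := ψℚ.fieldRange with hKt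
  have hmemKt : ∀ x : p.ring, τ x ∈ Kt := fun x => by
    rw [hKt, AlgHom.mem_fieldRange]
    exact ⟨IsLocalRing.residue p.ring x, rfl⟩
  have eKt : IsLocalRing.ResidueField p.ring ≃ₐ[ℚ] ψℚ.range := AlgEquiv.ofInjectiveField ψℚ
  have hfinrank : Module.finrank ℚ Kt = p.deg := by
    rw [Place.deg, eKt.toLinearEquiv.finrank_eq]
    rfl
  haveI hfdKt : FiniteDimensional ℚ Kt := by
    have : FiniteDimensional ℚ ψℚ.range := LinearEquiv.finiteDimensional eKt.toLinearEquiv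
    exact this
  refine ⟨p, τ, Kt, p.isReduction_comp_residue ψ.toRingHom, hmemKt, hfdKt, hfinrank, hAp, hττ₀, ?_⟩
  -- positivity of the order of the nonzero elements of the kernel
  intro a ha ha0
  have ha𝔪 : a ∈ 𝔪 := ha
  have haK0 : (a : K) ≠ 0 := fun h => ha0 (Subtype.ext h)
  have h1 := hmax1 a ha𝔪
  rw [ValuationSubring.valuation_lt_one_iff] at h1
  have h2 : 0 < v.ord (a : K) := (PlaceOver.valuation_lt_one_iff_ord_pos v haK0).mp h1
  rwa [hp, placeOfPlaceOver_ord]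
set_option synthInstance.maxHeartbeats 200000 in
set_option maxHeartbeats 800000 in
/-- **Step 1 (the homomorphism `τ₀ : ℚ[θ][β] → ℂ`, `θ ↦ α`, `β ↦ β̃`).** [cite: RoyWaldschmidt1997ENS, §3 (i), p. 765] -/
theorem exists_hom_adjoin (θ : K) (hθ : Transcendental ℚ θ) (β : K)
    (hβ : IsIntegral (Algebra.adjoin ℚ {θ}) β) (α βt : ℂ)
    (hroot : ((minpoly (Algebra.adjoin ℚ {θ}) β).map
      (Polynomial.algEquivOfTranscendental ℚ θ hθ).symm.toAlgHom.toRingHom).eval₂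
      (Polynomial.aeval α : ℚ[X] →ₐ[ℚ] ℂ).toRingHom βt = 0) :
    ∃ τ₀ : Algebra.adjoin (Algebra.adjoin ℚ {θ}) {β} →+* ℂ,
      (∀ g : ℚ[X], τ₀ (algebraMap (Algebra.adjoin ℚ {θ}) _ (Polynomial.algEquivOfTranscendental ℚ θ hθ g)) =
        aeval α g) ∧
      τ₀ ⟨β, Algebra.self_mem_adjoin_singleton _ β⟩ = βt := by
  haveI : UniqueFactorizationMonoid (Algebra.adjoin ℚ {θ}) :=
    MulEquiv.uniqueFactorizationMonoid (Polynomial.algEquivOfTranscendental ℚ θ hθ).toMulEquiv inferInstance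
  haveI : IsIntegrallyClosed (Algebra.adjoin ℚ {θ}) := UniqueFactorizationMonoid.instIsIntegrallyClosed
  have hroot' : (minpoly (Algebra.adjoin ℚ {θ}) β).eval₂
      ((Polynomial.aeval α : ℚ[X] →ₐ[ℚ] ℂ).toRingHom.comp
        (Polynomial.algEquivOfTranscendental ℚ θ hθ).symm.toAlgHom.toRingHom) βt = 0 := by
    rw [← Polynomial.eval₂_map]; exact hroot
  refine ⟨(AdjoinRoot.lift _ βt hroot').comp (minpoly.equivAdjoin hβ).symm.toAlgHom.toRingHom,
    fun g => ?_, ?_⟩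
  · rw [RingHom.comp_apply]
    have : (minpoly.equivAdjoin hβ).symm.toAlgHom.toRingHom
        (algebraMap (Algebra.adjoin ℚ {θ}) _ (Polynomial.algEquivOfTranscendental ℚ θ hθ g)) =
        algebraMap (Algebra.adjoin ℚ {θ}) (AdjoinRoot (minpoly (Algebra.adjoin ℚ {θ}) β))
          (Polynomial.algEquivOfTranscendental ℚ θ hθ g) := (minpoly.equivAdjoin hβ).symm.commutes _
    rw [this, AdjoinRoot.algebraMap_eq, AdjoinRoot.lift_of, RingHom.comp_apply]
    simp
  · rw [RingHom.comp_apply]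
    have : (minpoly.equivAdjoin hβ).symm.toAlgHom.toRingHom ⟨β, Algebra.self_mem_adjoin_singleton _ β⟩ =
        AdjoinRoot.root (minpoly (Algebra.adjoin ℚ {θ}) β) := by
      apply (minpoly.equivAdjoin hβ).injective
      show (minpoly.equivAdjoin hβ) ((minpoly.equivAdjoin hβ).symm _) = (minpoly.equivAdjoin hβ) (AdjoinRoot.root _)
      rw [AlgEquiv.apply_symm_apply]
      apply Subtype.ext
      show β = ↑(AdjoinRoot.Minpoly.toAdjoin (Algebra.adjoin ℚ {θ}) β (AdjoinRoot.mk _ X))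
      rw [AdjoinRoot.Minpoly.coe_toAdjoin_mk_X]
    rw [this, AdjoinRoot.lift_root]

set_option synthInstance.maxHeartbeats 400000 in
set_option maxHeartbeats 1600000 in
/-- **The place of `K` attached to `θ ↦ α`, `β ↦ β̃`** (Roy–Waldschmidt p. 765): for `θ ∈ K`
transcendental, `β ∈ K` integral over `ℚ[θ]`, `α, β̃ ∈ ℂ` algebraic with `β̃` a root of the
minimal polynomial of `β` over `ℚ[θ] ≅ ℚ[X]` specialised at `X ↦ α`, there are a place `𝔭` of
`K/ℚ`, a reduction map `τ` and the number field `K̃ = τ(𝒪_𝔭)` of degree `D = deg 𝔭` with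
`θ, β ∈ 𝒪_𝔭`, `τ(θ) = α`, `τ(β) = β̃` and `deg α ≤ D ≤ [K : ℚ(θ)] deg α`.
[cite: RoyWaldschmidt1997ENS, §3 (i), pp. 764–765] -/
theorem exists_place_of_specialization [IsAlgFunctionField ℚ K] (θ : K) (hθ : Transcendental ℚ θ)
    (β : K) (hβ : IsIntegral (Algebra.adjoin ℚ {θ}) β) {α βt : ℂ} (hα : IsIntegral ℚ α)
    (hβt : IsIntegral ℚ βt)
    (hroot : ((minpoly (Algebra.adjoin ℚ {θ}) β).map
      (Polynomial.algEquivOfTranscendental ℚ θ hθ).symm.toAlgHom.toRingHom).eval₂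
      (Polynomial.aeval α : ℚ[X] →ₐ[ℚ] ℂ).toRingHom βt = 0) :
    ∃ (p : Place K) (τ : p.ring →+* ℂ) (Kt : IntermediateField ℚ ℂ), p.IsReduction τ ∧
      (∀ x, τ x ∈ Kt) ∧ FiniteDimensional ℚ Kt ∧ Module.finrank ℚ Kt = p.deg ∧
      (∃ h : θ ∈ p.ring, τ ⟨θ, h⟩ = α) ∧ (∃ h : β ∈ p.ring, τ ⟨β, h⟩ = βt) ∧
      (minpoly ℚ α).natDegree ≤ p.deg ∧
      p.deg ≤ Module.finrank (IntermediateField.adjoin ℚ {θ}) K * (minpoly ℚ α).natDegree := by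
  classical
  obtain ⟨τ₀, hτ₀g, hτ₀β⟩ := exists_hom_adjoin θ hθ β hβ α βt hroot
  -- `A₀ = ℚ[θ][β]` as a `ℚ`-algebra, and `τ₀` as a `ℚ`-algebra homomorphism
  set R := Algebra.adjoin ℚ {θ} with hR
  set A₀ : Subalgebra ℚ K := (Algebra.adjoin (Algebra.adjoin ℚ {θ}) {β}).restrictScalars ℚ with hA₀
  have heθC : ∀ c : ℚ, Polynomial.algEquivOfTranscendental ℚ θ hθ (C c) = algebraMap ℚ _ c := fun c => by
    rw [Polynomial.C_eq_algebraMap, AlgEquiv.commutes]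
  have hθR : (θ : K) ∈ R := Algebra.self_mem_adjoin_singleton ℚ θ
  have heθcoe : ∀ g : ℚ[X], ((Polynomial.algEquivOfTranscendental ℚ θ hθ g : R) : K) = aeval θ g := fun g => by
    rw [Polynomial.algEquivOfTranscendental_apply, Polynomial.aeval_subalgebra_coe]
  -- membership of `θ`, `β` in `A₀`
  have hθA₀ : (θ : K) ∈ A₀ := by
    have : (θ : K) = ((algebraMap R (Algebra.adjoin R {β}) ⟨θ, hθR⟩ : Algebra.adjoin R {β}) : K) := rfl
    rw [hA₀, Subalgebra.mem_restrictScalars, this]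
    exact (algebraMap R (Algebra.adjoin R {β}) ⟨θ, hθR⟩).2
  have hβA₀ : β ∈ A₀ := by
    rw [hA₀, Subalgebra.mem_restrictScalars]; exact Algebra.self_mem_adjoin_singleton R β
  -- `τ₀` as a `ℚ`-algebra homomorphism on `A₀`
  have hmemA : ∀ x : A₀, (x : K) ∈ Algebra.adjoin R {β} := fun x => (Subalgebra.mem_restrictScalars ℚ).mp x.2
  have hτ₀ℚ : ∀ c : ℚ, τ₀ ⟨((algebraMap ℚ A₀ c : A₀) : K), hmemA _⟩ = algebraMap ℚ ℂ c := by
    intro c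
    have e : (⟨((algebraMap ℚ A₀ c : A₀) : K), hmemA _⟩ : Algebra.adjoin R {β}) =
        algebraMap R (Algebra.adjoin R {β}) (Polynomial.algEquivOfTranscendental ℚ θ hθ (C c)) := by
      rw [heθC]; rfl
    have h := hτ₀g (C c)
    rw [aeval_C] at h
    rw [e]
    exact h
  set τ₀' : A₀ →ₐ[ℚ] ℂ :=
    { toFun := fun x => τ₀ ⟨(x : K), hmemA x⟩
      map_one' := by
        have e : (⟨((1 : A₀) : K), hmemA 1⟩ : Algebra.adjoin R {β}) = 1 := Subtype.ext rfl
        simp only [e, map_one]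
      map_mul' := fun x y => by
        have e : (⟨((x * y : A₀) : K), hmemA (x * y)⟩ : Algebra.adjoin R {β}) =
            ⟨(x : K), hmemA x⟩ * ⟨(y : K), hmemA y⟩ := Subtype.ext rfl
        simp only [e, map_mul]
      map_zero' := by
        have e : (⟨((0 : A₀) : K), hmemA 0⟩ : Algebra.adjoin R {β}) = 0 := Subtype.ext rfl
        simp only [e, map_zero]
      map_add' := fun x y => by
        have e : (⟨((x + y : A₀) : K), hmemA (x + y)⟩ : Algebra.adjoin R {β}) =
            ⟨(x : K), hmemA x⟩ + ⟨(y : K), hmemA y⟩ := Subtype.ext rfl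
        simp only [e, map_add]
      commutes' := hτ₀ℚ } with hτ₀'
  have hτ₀'_apply : ∀ x : A₀, τ₀' x = τ₀ ⟨(x : K), hmemA x⟩ := fun x => rfl
  have hτ₀'θ : τ₀' ⟨θ, hθA₀⟩ = α := by
    rw [hτ₀'_apply]
    have e : (⟨((⟨θ, hθA₀⟩ : A₀) : K), hmemA _⟩ : Algebra.adjoin R {β}) =
        algebraMap R (Algebra.adjoin R {β}) (Polynomial.algEquivOfTranscendental ℚ θ hθ X) := by
      apply Subtype.ext
      show (θ : K) = ((Polynomial.algEquivOfTranscendental ℚ θ hθ X : R) : K)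
      rw [heθcoe, aeval_X]
    have h := hτ₀g X
    rw [aeval_X] at h
    rw [e]; exact h
  have hτ₀'β : τ₀' ⟨β, hβA₀⟩ = βt := by
    rw [hτ₀'_apply]
    exact hτ₀β
  have hτ₀'g : ∀ g : ℚ[X], τ₀' ⟨((algebraMap R (Algebra.adjoin R {β}) (Polynomial.algEquivOfTranscendental ℚ θ hθ g)
      : Algebra.adjoin R {β}) : K), by rw [hA₀, Subalgebra.mem_restrictScalars]; exact Subtype.mem _⟩ = aeval α g := by
    intro g
    rw [hτ₀'_apply]
    exact hτ₀g g
  -- `A₀ = ℚ[θ, β]` and the values of `τ₀'` are algebraic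
  have hA₀eq : A₀ = Algebra.adjoin ℚ ({(θ : K)} ∪ {β}) := by
    rw [hA₀, Algebra.adjoin_union_eq_adjoin_adjoin]
  have key : ∀ (y : K) (_hy : y ∈ Algebra.adjoin ℚ ({(θ : K)} ∪ {β})) (hy' : y ∈ A₀),
      IsIntegral ℚ (τ₀' ⟨y, hy'⟩) := by
    intro y hy
    induction hy using Algebra.adjoin_induction with
    | mem z hz =>
      intro hz'
      rcases hz with hz | hz
      · rw [Set.mem_singleton_iff] at hz
        subst z
        rw [hτ₀'θ]; exact hα
      · rw [Set.mem_singleton_iff] at hz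
        subst z
        rw [hτ₀'β]; exact hβt
    | algebraMap c =>
      intro hc'
      have e : (⟨algebraMap ℚ K c, hc'⟩ : A₀) = algebraMap ℚ A₀ c := rfl
      rw [e, AlgHom.commutes]; exact isIntegral_algebraMap
    | add y z hy hz ihy ihz =>
      intro hyz'
      have hy' : y ∈ A₀ := by rw [hA₀eq]; exact hy
      have hz' : z ∈ A₀ := by rw [hA₀eq]; exact hz
      have e : (⟨y + z, hyz'⟩ : A₀) = ⟨y, hy'⟩ + ⟨z, hz'⟩ := rfl
      rw [e, map_add]; exact (ihy hy').add (ihz hz')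
    | mul y z hy hz ihy ihz =>
      intro hyz'
      have hy' : y ∈ A₀ := by rw [hA₀eq]; exact hy
      have hz' : z ∈ A₀ := by rw [hA₀eq]; exact hz
      have e : (⟨y * z, hyz'⟩ : A₀) = ⟨y, hy'⟩ * ⟨z, hz'⟩ := rfl
      rw [e, map_mul]; exact (ihy hy').mul (ihz hz')
  have halg : ∀ x : A₀, IsAlgebraic ℚ (τ₀' x) := by
    intro x
    have hx : (x : K) ∈ Algebra.adjoin ℚ ({(θ : K)} ∪ {β}) := by rw [← hA₀eq]; exact x.2
    exact (key x hx x.2).isAlgebraic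
  -- a nonzero element of the kernel: `m_α(θ)`
  have hq0 : minpoly ℚ α ≠ 0 := minpoly.ne_zero hα
  set a₀ : A₀ := ⟨((algebraMap R (Algebra.adjoin R {β}) (Polynomial.algEquivOfTranscendental ℚ θ hθ (minpoly ℚ α))
      : Algebra.adjoin R {β}) : K), by rw [hA₀, Subalgebra.mem_restrictScalars]; exact Subtype.mem _⟩ with ha₀
  have ha₀K : (a₀ : K) = aeval θ (minpoly ℚ α) := heθcoe _
  have ha₀0 : a₀ ≠ 0 := fun h => by
    have h1 : aeval θ (minpoly ℚ α) = 0 := by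
      rw [← ha₀K, h]; rfl
    exact hθ ⟨minpoly ℚ α, hq0, h1⟩
  have ha₀τ : τ₀' a₀ = 0 := by rw [ha₀, hτ₀'g, minpoly.aeval]
  obtain ⟨p, τ, Kt, hred, hKt, hfd, hdeg, hA, hττ₀, hord⟩ :=
    exists_place_of_hom A₀ τ₀' halg ⟨a₀, ha₀0, ha₀τ⟩
  haveI := hfd
  refine ⟨p, τ, Kt, hred, hKt, hfd, hdeg, ⟨hA ⟨θ, hθA₀⟩, (hττ₀ ⟨θ, hθA₀⟩).trans hτ₀'θ⟩,
    ⟨hA ⟨β, hβA₀⟩, (hττ₀ ⟨β, hβA₀⟩).trans hτ₀'β⟩, ?_, ?_⟩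
  · -- `d ≤ D`: `ℚ(α) ⊆ K̃`
    have hαKt : α ∈ Kt := by rw [← hτ₀'θ, ← hττ₀]; exact hKt _
    have hle : IntermediateField.adjoin ℚ {α} ≤ Kt := IntermediateField.adjoin_simple_le_iff.mpr hαKt
    have h1 := IntermediateField.finrank_bot_mul_relfinrank hle
    rw [IntermediateField.adjoin.finrank hα] at h1
    have hpos : 0 < Module.finrank ℚ Kt := Module.finrank_pos
    rw [← hdeg, ← h1]
    have hr : IntermediateField.relfinrank (IntermediateField.adjoin ℚ {α}) Kt ≠ 0 := by
      intro h0; rw [h0, mul_zero] at h1; omega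
    exact Nat.le_mul_of_pos_right _ (Nat.pos_of_ne_zero hr)
  · -- `D ≤ [K : ℚ(θ)] d`: Stichtenoth Prop. 1.3.3 at `x = m_α(θ)` and the tower `ℚ(x) ⊆ ℚ(θ) ⊆ K`
    set x : K := aeval θ (minpoly ℚ α) with hx
    have hd1 : (minpoly ℚ α).natDegree ≠ 0 := (minpoly.natDegree_pos hα).ne'
    have hxtr : Transcendental ℚ x :=
      hθ.aeval (minpoly ℚ α) hd1 (by rw [minpoly.monic hα]; exact one_mem _)
    have hordx : 0 < p.toPlaceOver.ord x := by
      rw [Place.ord_toPlaceOver]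
      have h := hord a₀ ha₀τ ha₀0
      rw [ha₀K] at h
      exact h
    have h133 := sum_ord_mul_degree_le_finrank hxtr {p.toPlaceOver} (by simpa using hordx)
    rw [Finset.sum_singleton, Place.degree_toPlaceOver] at h133
    have htoNat : 1 ≤ (p.toPlaceOver.ord x).toNat :=
      (Int.le_toNat hordx.le).mpr (by exact_mod_cast hordx)
    have h1 : p.deg ≤ Module.finrank (IntermediateField.adjoin ℚ {x}) K :=
      le_trans (Nat.le_mul_of_pos_left _ htoNat) h133
    -- the tower
    have hxθ : x ∈ IntermediateField.adjoin ℚ {θ} :=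
      IntermediateField.algebra_adjoin_le_adjoin ℚ {θ} (hx ▸ Polynomial.aeval_mem_adjoin_singleton ℚ θ)
    have hle : IntermediateField.adjoin ℚ {x} ≤ IntermediateField.adjoin ℚ {θ} :=
      IntermediateField.adjoin_simple_le_iff.mpr hxθ
    have htower := IntermediateField.relfinrank_mul_finrank_top hle
    -- `relfinrank ℚ(x) ℚ(θ) ≤ d`
    have hext : IntermediateField.extendScalars hle =
        IntermediateField.adjoin (IntermediateField.adjoin ℚ {x}) {θ} := by
      apply le_antisymm
      · -- `ℚ(θ) ⊆ ℚ(x)(θ)`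
        intro z hz
        rw [IntermediateField.mem_extendScalars] at hz
        have hle' : IntermediateField.adjoin ℚ {θ} ≤
            (IntermediateField.adjoin (IntermediateField.adjoin ℚ {x}) {θ}).restrictScalars ℚ :=
          IntermediateField.adjoin_le_iff.mpr (Set.singleton_subset_iff.mpr
            (IntermediateField.mem_adjoin_simple_self _ θ))
        exact hle' hz
      · exact IntermediateField.adjoin_le_iff.mpr (Set.singleton_subset_iff.mpr
          ((IntermediateField.mem_extendScalars (h := hle)).mpr (IntermediateField.mem_adjoin_simple_self ℚ θ)))
    set PA : (IntermediateField.adjoin ℚ {x})[X] := (minpoly ℚ α).map (algebraMap ℚ (IntermediateField.adjoin ℚ {x})) -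
      C ⟨x, IntermediateField.mem_adjoin_simple_self ℚ x⟩ with hPA
    have hmapmonic : ((minpoly ℚ α).map (algebraMap ℚ (IntermediateField.adjoin ℚ {x}))).Monic := (minpoly.monic hα).map _
    have hdegmap : ((minpoly ℚ α).map (algebraMap ℚ (IntermediateField.adjoin ℚ {x}))).natDegree =
        (minpoly ℚ α).natDegree :=
      natDegree_map_eq_of_injective (algebraMap ℚ (IntermediateField.adjoin ℚ {x})).injective _
    have hdeglt : (C (⟨x, IntermediateField.mem_adjoin_simple_self ℚ x⟩ : IntermediateField.adjoin ℚ {x})).degree <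
        ((minpoly ℚ α).map (algebraMap ℚ (IntermediateField.adjoin ℚ {x}))).degree := by
      refine lt_of_le_of_lt degree_C_le ?_
      rw [degree_eq_natDegree hmapmonic.ne_zero, hdegmap]
      exact_mod_cast Nat.pos_of_ne_zero hd1
    have hPAmonic : PA.Monic := hmapmonic.sub_of_left hdeglt
    have hPAdeg : PA.natDegree = (minpoly ℚ α).natDegree := by
      rw [hPA, natDegree_eq_of_degree_eq (degree_sub_eq_left_of_degree_lt hdeglt), hdegmap]
    have hPAroot : aeval θ PA = 0 := by
      rw [hPA, map_sub, aeval_map_algebraMap, aeval_C]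
      show aeval θ (minpoly ℚ α) - x = 0
      rw [hx, sub_self]
    have hθint : IsIntegral (IntermediateField.adjoin ℚ {x}) θ := ⟨PA, hPAmonic, by rwa [← aeval_def]⟩
    have hrel : IntermediateField.relfinrank (IntermediateField.adjoin ℚ {x}) (IntermediateField.adjoin ℚ {θ}) ≤
        (minpoly ℚ α).natDegree := by
      rw [IntermediateField.relfinrank_eq_finrank_of_le hle, hext, IntermediateField.adjoin.finrank hθint,
        ← hPAdeg]
      exact natDegree_le_natDegree (minpoly.min (IntermediateField.adjoin ℚ {x}) θ hPAmonic hPAroot)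
    calc p.deg ≤ Module.finrank (IntermediateField.adjoin ℚ {x}) K := h1
      _ = IntermediateField.relfinrank (IntermediateField.adjoin ℚ {x}) (IntermediateField.adjoin ℚ {θ}) *
            Module.finrank (IntermediateField.adjoin ℚ {θ}) K := htower.symm
      _ ≤ (minpoly ℚ α).natDegree * Module.finrank (IntermediateField.adjoin ℚ {θ}) K :=
          Nat.mul_le_mul_right _ hrel
      _ = _ := mul_comm _ _


end RoyWaldschmidt1997

end Literature.NumberTheory.Transcendental
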